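import Literature.Analysis.FluidPDE.TypeIAncientMild
import Literature.Analysis.FluidPDE.TypeIAncientMildClassical
import Literature.Analysis.FluidPDE.VorticityEquation
import Literature.Analysis.FluidPDE.ESSBackwardUniquenessHolds
import Literature.Analysis.FluidPDE.LocalAffineChainRules
import Summits.NavierStokesRegularity.NavierStokesRegularity.Theorems.ClockStretchingLawClockCeilingStubUniformBounds
import HarnessLib

/-!
# Route ClockStretchingLaw — crux `ClockCeiling`, line `registered`: stub
# `stub_vorticitySupportBackward`

Helper file (supports item stmt-NavierStokesRegularity-10570, crux `ClockCeiling` of route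
`ClockStretchingLaw` of `NavierStokesRegularity`): **backward propagation of the vorticity support
of an element of the route's Type-I class** `IsTypeIAncientMild C u` (jointly smooth on `t < 0`,
divergence free, KNSS/Oseen-mild, `‖u(t,x)‖ ≤ C/√(-t)`): if `ω = curl u` vanishes on `{‖x‖ > R}`
at one time `t₀ < 0`, it vanishes there at every earlier time `t ≤ t₀`.

Proof: Escauriaza–Seregin–Šverák's backward uniqueness across a half-space for the backward heat
operator with bounded lower-order terms (ESS 2003, Thm. 5.1, proved in the tree:
`ess_backward_uniqueness_holds`), applied as in ESS 2003, §3, (3.32)–(3.35), to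
`W(s, y) = c ω(t₀ - τ s, R e + √τ y)` on `]0,1[ × {⟪y, e⟫ > 0}` (`‖e‖ = 1`, `τ > 0`): `ω` solves
`∂ₜω + (u·∇)ω = (ω·∇)u + Δω` on every window
(`IsTypeIAncientMild.exists_isClassicalNSSolutionOn_Ioo`, `IsClassicalNSSolutionOn.vorticity_eq`),
and `u, ∇u, ω, ∇ω, ∇²ω, ∂ₜω` are bounded on
`(-∞, t₀] × ℝ³` (`uniformBounds_exists_mixed`, KNSS 2009, Prop. 4.1), which gives (5.1) with
`c₁ = τM₀(τ^{-1/2} + 1)`, (5.3) with `M = 0` after normalising, (5.4), and (5.2) from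
`⟪R e + √τ y, e⟫ = R + √τ⟪y, e⟫`. The half-spaces `{⟪x, e⟫ > R}` cover `{‖x‖ > R}`.

## References

* L. Escauriaza, G. Seregin, V. Šverák, *`L_{3,∞}`-solutions of Navier–Stokes equations and
  backward uniqueness*, Russ. Math. Surveys 58:2 (2003) 211–250, Thm. 5.1 and §3 (3.32)–(3.35).
* G. Koch, N. Nadirashvili, G. Seregin, V. Šverák, *Liouville theorems for the Navier–Stokes
  equations and applications*, Acta Math. 203 (2009) = arXiv:0709.3599, Prop. 4.1.
-/

set_option linter.dupNamespace false

noncomputable section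

open Literature.Analysis.FluidPDE MeasureTheory Set Function Filter Topology
open scoped ENNReal NNReal RealInnerProductSpace Laplacian ContDiff

namespace Summit.NavierStokesRegularity.NavierStokesRegularity.Theorems

/-- Every vector of `ℝ³` is `‖x‖` times a unit vector: there is `e`, `‖e‖ = 1`, with
`⟪x, e⟫ = ‖x‖` (`e = x/‖x‖`, or any unit vector if `x = 0`). [folklore] -/
theorem vorticitySupportBackward_exists_unit (x : EuclideanSpace ℝ (Fin 3)) :
    ∃ e : EuclideanSpace ℝ (Fin 3), ‖e‖ = 1 ∧ ⟪x, e⟫ = ‖x‖ := by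
  by_cases hx : x = 0
  · refine ⟨EuclideanSpace.single 0 1, by simp, ?_⟩
    rw [hx, inner_zero_left, norm_zero]
  · have hn : 0 < ‖x‖ := norm_pos_iff.2 hx
    refine ⟨‖x‖⁻¹ • x, ?_, ?_⟩
    · rw [norm_smul, norm_inv, norm_norm, inv_mul_cancel₀ hn.ne']
    · rw [real_inner_smul_right, real_inner_self_eq_norm_sq, pow_two, ← mul_assoc,
        inv_mul_cancel₀ hn.ne', one_mul]

/-! ### Bounds and the vorticity equation for the class -/

section Class

variable {C : ℝ} {u : ℝ → EuclideanSpace ℝ (Fin 3) → EuclideanSpace ℝ (Fin 3)}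

/-- **Uniform bounds on a backward end.** For a Type I ancient mild field `u` and `t₀ < 0` there is
`M₀ ≥ 0` bounding `u`, `∇u`, `ω`, `∇ω`, `∇²ω`, `∂ₜω` (`ω = vorticity u`) on `(-∞, t₀] × ℝ³`: the
scale-invariant bounds `‖∇ᵏ∂ₜˡu(t)‖ ≤ K(C)(-t)^{-(k+1)/2-l}` of the class
(`uniformBounds_exists_mixed`, KNSS 2009, Prop. 4.1) are monotone on `t ≤ t₀`, `ω = curlCLM ∘ ∇u`,
and `∂ₜω = curl ∂ₜu` (`IsSmoothSpaceTimeOn.curl_timeDerivWithin`). [cite: KochNadirashviliSereginSverak2009, Prop. 4.1 (arXiv:0709.3599 p. 8)] -/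
theorem vorticitySupportBackward_bounds (hu : IsTypeIAncientMild C u) {t₀ : ℝ} (ht₀ : t₀ < 0) :
    ∃ M₀ : ℝ, 0 ≤ M₀ ∧ ∀ t ≤ t₀, ∀ x,
      ‖u t x‖ ≤ M₀ ∧ ‖fderiv ℝ (u t) x‖ ≤ M₀ ∧ ‖vorticity u t x‖ ≤ M₀ ∧
      ‖fderiv ℝ (vorticity u t) x‖ ≤ M₀ ∧ ‖iteratedFDeriv ℝ 2 (vorticity u t) x‖ ≤ M₀ ∧
      ‖timeDeriv (vorticity u) t x‖ ≤ M₀ := by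
  obtain ⟨K₁, hK₁0, hK₁⟩ := uniformBounds_exists_mixed 1 0 (-(1 : ℝ)) (by norm_num)
  obtain ⟨K₂, hK₂0, hK₂⟩ := uniformBounds_exists_mixed 2 0 (-(3 : ℝ) / 2) (by norm_num)
  obtain ⟨K₃, hK₃0, hK₃⟩ := uniformBounds_exists_mixed 3 0 (-(2 : ℝ)) (by norm_num)
  obtain ⟨K₄, hK₄0, hK₄⟩ := uniformBounds_exists_mixed 1 1 (-(2 : ℝ)) (by norm_num)
  have hC : 0 ≤ C := hu.nonneg
  have hnt₀ : 0 < -t₀ := neg_pos.2 ht₀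
  set κ : ℝ := ‖curlCLM‖ with hκ
  have hκ0 : 0 ≤ κ := norm_nonneg curlCLM
  -- the bounds at `t₀`
  set B₀ : ℝ := C / Real.sqrt (-t₀) with hB₀
  set B₁ : ℝ := K₁ C * (-t₀) ^ (-(1 : ℝ)) with hB₁
  set B₂ : ℝ := K₂ C * (-t₀) ^ (-(3 : ℝ) / 2) with hB₂
  set B₃ : ℝ := K₃ C * (-t₀) ^ (-(2 : ℝ)) with hB₃
  set B₄ : ℝ := K₄ C * (-t₀) ^ (-(2 : ℝ)) with hB₄
  have hB₀0 : 0 ≤ B₀ := div_nonneg hC (Real.sqrt_nonneg _)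
  have hB₁0 : 0 ≤ B₁ := mul_nonneg (hK₁0 C hC) (Real.rpow_nonneg hnt₀.le _)
  have hB₂0 : 0 ≤ B₂ := mul_nonneg (hK₂0 C hC) (Real.rpow_nonneg hnt₀.le _)
  have hB₃0 : 0 ≤ B₃ := mul_nonneg (hK₃0 C hC) (Real.rpow_nonneg hnt₀.le _)
  have hB₄0 : 0 ≤ B₄ := mul_nonneg (hK₄0 C hC) (Real.rpow_nonneg hnt₀.le _)
  refine ⟨B₀ + B₁ + κ * B₁ + κ * B₂ + κ * B₃ + κ * B₄, by positivity, fun t ht x => ?_⟩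
  have htn : t < 0 := lt_of_le_of_lt ht ht₀
  have hle : -t₀ ≤ -t := neg_le_neg ht
  have hw : ∀ e : ℝ, e ≤ 0 → (-t) ^ e ≤ (-t₀) ^ e := fun e he =>
    Real.rpow_le_rpow_of_nonpos hnt₀ hle he
  have hsm : IsSmoothSpaceTimeOn (Iio 0) u := hu.contDiffOn
  have hslice : ContDiff ℝ ∞ (u t) := hu.contDiff_slice htn
  have h₁ := hK₁ C u hu t htn x
  have h₂ := hK₂ C u hu t htn x
  have h₃ := hK₃ C u hu t htn x
  have h₄ := hK₄ C u hu t htn x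
  simp only [norm_iteratedFDeriv_one, iteratedDeriv_one, iteratedDeriv_zero] at h₁ h₂ h₃ h₄
  -- `u` and `∇u`
  have hu0 : ‖u t x‖ ≤ B₀ := (hu.norm_le htn x).trans
    (div_le_div_of_nonneg_left hC (Real.sqrt_pos.2 hnt₀) (Real.sqrt_le_sqrt hle))
  have hu1 : ‖fderiv ℝ (u t) x‖ ≤ B₁ :=
    h₁.trans (mul_le_mul_of_nonneg_left (hw _ (by norm_num)) (hK₁0 C hC))
  have hu2 : ‖iteratedFDeriv ℝ 2 (u t) x‖ ≤ B₂ :=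
    h₂.trans (mul_le_mul_of_nonneg_left (hw _ (by norm_num)) (hK₂0 C hC))
  have hu3 : ‖iteratedFDeriv ℝ 3 (u t) x‖ ≤ B₃ :=
    h₃.trans (mul_le_mul_of_nonneg_left (hw _ (by norm_num)) (hK₃0 C hC))
  have hu4 : ‖fderiv ℝ (fun y => deriv (fun s => u s y) t) x‖ ≤ B₄ :=
    h₄.trans (mul_le_mul_of_nonneg_left (hw _ (by norm_num)) (hK₄0 C hC))
  -- `ω`, `∇ω`, `∇²ω`
  have hω0 : ‖vorticity u t x‖ ≤ κ * B₁ :=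
    (norm_curl_le (u t) x).trans (mul_le_mul_of_nonneg_left hu1 hκ0)
  have hω1 : ‖fderiv ℝ (vorticity u t) x‖ ≤ κ * B₂ :=
    (norm_fderiv_curl_le (contDiff_infty.1 hslice 2) x).trans (mul_le_mul_of_nonneg_left hu2 hκ0)
  have hω2 : ‖iteratedFDeriv ℝ 2 (vorticity u t) x‖ ≤ κ * B₃ := by
    have hDv : ContDiff ℝ 2 (fderiv ℝ (u t)) :=
      contDiff_infty.1 (contDiff_infty_iff_fderiv.1 hslice).2 2
    rw [vorticity_apply, curl_eq_curlCLM_comp,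
      ContinuousLinearMap.iteratedFDeriv_comp_left curlCLM (hDv.contDiffAt (x := x)) le_rfl]
    refine (ContinuousLinearMap.norm_compContinuousMultilinearMap_le _ _).trans ?_
    rw [norm_iteratedFDeriv_fderiv]
    exact mul_le_mul_of_nonneg_left hu3 hκ0
  -- `∂ₜω = curl ∂ₜu`
  have hωt : ‖timeDeriv (vorticity u) t x‖ ≤ κ * B₄ := by
    have e1 : timeDeriv (vorticity u) t x = curl (timeDerivWithin (Iio 0) u t) x := by
      rw [hsm.curl_timeDerivWithin isOpen_Iio.uniqueDiffOn
          (by rw [interior_Iio]; exact subset_closure) htn x,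
        timeDerivWithin_eq_deriv_of_isOpen_subset isOpen_Iio subset_rfl htn (vorticity u),
        timeDeriv_apply]
    rw [e1, timeDerivWithin_eq_deriv_of_isOpen_subset isOpen_Iio subset_rfl htn u]
    exact (norm_curl_le _ x).trans (mul_le_mul_of_nonneg_left hu4 hκ0)
  refine ⟨hu0.trans ?_, hu1.trans ?_, hω0.trans ?_, hω1.trans ?_, hω2.trans ?_, hωt.trans ?_⟩ <;>
    linarith [mul_nonneg hκ0 hB₁0, mul_nonneg hκ0 hB₂0, mul_nonneg hκ0 hB₃0, mul_nonneg hκ0 hB₄0]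

/-- **The vorticity equation with the two-sided time derivative** for a Type I ancient mild
field: `∂ₜω = Δω - (u·∇)ω + (ω·∇)u` at every `t < 0` (the field is classical on the window
`(t - 1, 0)`, `IsTypeIAncientMild.exists_isClassicalNSSolutionOn_Ioo`; Majda–Bertozzi (2.110),
`IsClassicalNSSolutionOn.vorticity_eq`; the window is open, so the one-sided time derivative is
the two-sided one). [cite: MajdaBertozziCUP2002, §2.4 Prop. 2.4 eq. (2.110)] -/
theorem vorticitySupportBackward_vorticity_eq (hu : IsTypeIAncientMild C u) {t : ℝ} (ht : t < 0)
    (x : EuclideanSpace ℝ (Fin 3)) :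
    timeDeriv (vorticity u) t x = (Δ (vorticity u t)) x - convect (u t) (vorticity u t) x +
      convect (vorticity u t) (u t) x := by
  obtain ⟨p, hcl⟩ := hu.exists_isClassicalNSSolutionOn_Ioo (t₀ := t - 1) (by linarith)
  have hS : IsOpen (Ioo (t - 1) (0 : ℝ)) := isOpen_Ioo
  have htS : t ∈ Ioo (t - 1) (0 : ℝ) := ⟨by linarith, ht⟩
  have key := hcl.vorticity_eq hS.uniqueDiffOn (by rw [hS.interior_eq]; exact subset_closure)
    (fun _ _ y => curl_zero y) htS x
  rw [timeDerivWithin_eq_deriv_of_isOpen_subset hS subset_rfl htS (vorticity u), one_smul] at key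
  rw [timeDeriv_apply, sub_add_eq_add_sub, eq_sub_iff_add_eq, key, add_comm]

/-! ### Backward uniqueness across a half-space -/

/-- **Backward propagation of vanishing vorticity across a half-space** (ESS 2003, Thm. 5.1,
applied as in ESS 2003, §3, (3.32)–(3.35)): if the vorticity of a Type I ancient mild field
vanishes at time `t₀ < 0` on the half-space `{⟪x, e⟫ > R}` (`‖e‖ = 1`), then it vanishes there at
every time `t ∈ (t₀ - τ, t₀)`, `τ > 0`. The field `W(s, y) = c ω(t₀ - τ s, R e + √τ y)`
(`c = 1/max(M₀, 1)`, `M₀` the bound of `vorticitySupportBackward_bounds`) satisfies on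
`]0,1[ × {⟪y, e⟫ > 0}` the hypotheses of `ess_backward_uniqueness` with
`c₁ = τ M₀ (τ^{-1/2} + 1)`, `M = 0`. [cite: EscauriazaSereginSverak2003, Thm. 5.1 and §3 (3.32)–(3.35)] -/
theorem vorticitySupportBackward_halfspace (hu : IsTypeIAncientMild C u) {t₀ : ℝ} (ht₀ : t₀ < 0)
    {e : EuclideanSpace ℝ (Fin 3)} (he : ‖e‖ = 1) {R : ℝ}
    (hR : ∀ x, R < ⟪x, e⟫ → vorticity u t₀ x = 0) {τ : ℝ} (hτ : 0 < τ) {t : ℝ}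
    (ht : t ∈ Ioo (t₀ - τ) t₀) {x : EuclideanSpace ℝ (Fin 3)} (hx : R < ⟪x, e⟫) :
    vorticity u t x = 0 := by
  obtain ⟨M₀, hM₀, hb⟩ := vorticitySupportBackward_bounds hu ht₀
  have homeq : ∀ t < 0, ∀ x, timeDeriv (vorticity u) t x = (Δ (vorticity u t)) x -
      convect (u t) (vorticity u t) x + convect (vorticity u t) (u t) x :=
    fun t ht x => vorticitySupportBackward_vorticity_eq hu ht x
  have homS : IsSmoothSpaceTimeOn (Iio 0) (vorticity u) :=
    (show IsSmoothSpaceTimeOn (Iio 0) u from hu.contDiffOn).isSmoothSpaceTimeOn_vorticity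
      isOpen_Iio.uniqueDiffOn
  have hom1 : ContDiffOn ℝ ∞ (uncurry (vorticity u)) (Iio 0 ×ˢ univ) := homS
  have homx : ∀ t < 0, ContDiff ℝ 2 (vorticity u t) := fun t ht =>
    contDiff_infty.1 (homS.contDiff_slice ht) 2
  generalize homdef : vorticity u = om at hb homeq hom1 homx hR ⊢
  set lam : ℝ := Real.sqrt τ with hlam
  have hlampos : 0 < lam := Real.sqrt_pos.2 hτ
  have hlam2 : lam ^ 2 = τ := Real.sq_sqrt hτ.le
  set xc := R • e with hxc
  have hee : ⟪e, e⟫ = 1 := by rw [real_inner_self_eq_norm_sq, he, one_pow]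
  have hAyR : ∀ y, 0 < ⟪y, e⟫ → R < ⟪xc + lam • y, e⟫ := fun y hy => by
    rw [inner_add_left, real_inner_smul_left, real_inner_smul_left, hee, mul_one]
    linarith [mul_pos hlampos hy]
  have htime' : ∀ s ∈ Ioo (0 : ℝ) 1, t₀ + -τ * s ≤ t₀ := fun s hs => by nlinarith [hs.1, hτ]
  have htime0' : ∀ s ∈ Ioo (0 : ℝ) 1, t₀ + -τ * s < 0 := fun s hs => (htime' s hs).trans_lt ht₀
  have hmaps : MapsTo (stAffine (-τ) lam t₀ xc) (Ico (0 : ℝ) 1 ×ˢ {y | 0 < ⟪y, e⟫})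
      (Iio 0 ×ˢ univ) := fun z hz =>
    ⟨show t₀ + -τ * z.1 < 0 by nlinarith [hz.1.1, hτ], mem_univ _⟩
  set c : ℝ := (max M₀ 1)⁻¹ with hc
  have hmaxpos : 0 < max M₀ 1 := lt_max_of_lt_right one_pos
  have hcpos : 0 < c := inv_pos.2 hmaxpos
  have hcM₀ : c * M₀ ≤ 1 := by
    rw [hc, inv_mul_le_iff₀ hmaxpos, mul_one]; exact le_max_left _ _
  set W := c • stPull (-τ) lam t₀ xc om with hWdef
  have hWapply : ∀ s y, W s y = c • om (t₀ + -τ * s) (xc + lam • y) := fun s y => rfl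
  have hopen : IsOpen (Iio (0 : ℝ) ×ˢ (univ : Set (EuclideanSpace ℝ (Fin 3)))) :=
    isOpen_Iio.prod isOpen_univ
  have homtdiff : ∀ t < 0, ∀ x, DifferentiableAt ℝ (fun r => om r x) t := by
    intro t ht x
    have h1 : DifferentiableAt ℝ (uncurry om) (t, x) :=
      (hom1.contDiffAt (hopen.mem_nhds (mk_mem_prod ht (mem_univ x)))).differentiableAt (by simp)
    have h2 : DifferentiableAt ℝ (fun r : ℝ => (r, x)) t := by fun_prop
    exact h1.comp t h2
  -- (b) regularity of `W` on `Q₊ = ]0,1[ × H` and continuity up to `s = 0`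
  have hΦc : ContDiff ℝ ∞ (stAffine (-τ) lam t₀ xc) := contDiff_stAffine _ _ _ _
  have hR2 : ContDiffOn ℝ 2 (uncurry W) (Ioo (0 : ℝ) 1 ×ˢ {y | 0 < ⟪y, e⟫}) := by
    have e1 : uncurry W = fun z => c • (uncurry om ∘ stAffine (-τ) lam t₀ xc) z := by
      funext ⟨s, y⟩; rfl
    rw [e1]
    exact ((contDiffOn_infty.1 hom1 2).comp (contDiff_infty.1 hΦc 2).contDiffOn
      fun z hz => hmaps ⟨Ioo_subset_Ico_self hz.1, hz.2⟩).const_smul c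
  have hRc : ContinuousOn (uncurry W) (Ico (0 : ℝ) 1 ×ˢ {y | 0 < ⟪y, e⟫}) := by
    have e1 : uncurry W = fun z => c • (uncurry om ∘ stAffine (-τ) lam t₀ xc) z := by
      funext ⟨s, y⟩; rfl
    rw [e1]
    exact (hom1.continuousOn.comp hΦc.continuous.continuousOn hmaps).const_smul c
  -- (c) derivatives of `W` at a point of `Q₊` in terms of those of `om` at the image point
  have hWt : ∀ s ∈ Ioo (0 : ℝ) 1, ∀ y,
      timeDeriv W s y = (c * -τ) • timeDeriv om (t₀ + -τ * s) (xc + lam • y) := by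
    intro s hs y
    have hd : DifferentiableAt ℝ (fun r => stPull (-τ) lam t₀ xc om r y) s := by
      have h1 := homtdiff _ (htime0' s hs) (xc + lam • y)
      have h2 : DifferentiableAt ℝ (fun r : ℝ => t₀ + -τ * r) s := by fun_prop
      exact h1.comp s h2
    have e1 : timeDeriv W s y = c • timeDeriv (stPull (-τ) lam t₀ xc om) s y := by
      simp only [hWdef, timeDeriv_apply, Pi.smul_apply]; exact deriv_const_smul c hd
    rw [e1, timeDeriv_stPull, smul_smul]
  have hWx : ∀ s ∈ Ioo (0 : ℝ) 1, ∀ y,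
      fderiv ℝ (W s) y = (c * lam) • fderiv ℝ (om (t₀ + -τ * s)) (xc + lam • y) := by
    intro s hs y
    have hd : DifferentiableAt ℝ (stPull (-τ) lam t₀ xc om s) y := by
      have h1 : DifferentiableAt ℝ (om (t₀ + -τ * s)) (xc + lam • y) :=
        ((homx _ (htime0' s hs)).differentiable (by simp)).differentiableAt
      have h2 : DifferentiableAt ℝ (fun y => xc + lam • y) y := by fun_prop
      exact h1.comp y h2
    have e1 : W s = c • stPull (-τ) lam t₀ xc om s := rfl
    rw [e1, fderiv_const_smul hd, fderiv_stPull, smul_smul]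
  have hWlap : ∀ s ∈ Ioo (0 : ℝ) 1, ∀ y,
      (Δ (W s)) y = (c * lam ^ 2) • (Δ (om (t₀ + -τ * s))) (xc + lam • y) ∧
      ‖iteratedFDeriv ℝ 2 (W s) y‖ ≤ c * lam ^ 2 * M₀ := by
    intro s hs y
    have ht' := htime0' s hs
    have hcω : ContDiff ℝ 2 (fun x => c • om (t₀ + -τ * s) x) := (homx _ ht').const_smul c
    have e1 : W s = fun z => (fun x => c • om (t₀ + -τ * s) x) (xc + lam • z) := rfl
    refine ⟨?_, ?_⟩
    · rw [e1, laplacian_comp_affine_of_contDiffOn hcω.contDiffOn isOpen_univ xc lam (mem_univ _)]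
      have e2 : (fun x => c • om (t₀ + -τ * s) x) =
          (c • ContinuousLinearMap.id ℝ (EuclideanSpace ℝ (Fin 3))) ∘ om (t₀ + -τ * s) := by
        funext x; simp
      rw [e2, ContDiffAt.laplacian_CLM_comp_left ((homx _ ht').contDiffAt)]
      simp [smul_smul, mul_comm]
    · rw [e1]
      refine (norm_iteratedFDeriv_two_comp_affine_le hcω.contDiffOn isOpen_univ xc lam
        (mem_univ _)).trans ?_
      rw [iteratedFDeriv_const_smul_apply' ((homx _ ht').contDiffAt), norm_smul,
        Real.norm_eq_abs, abs_of_pos hcpos]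
      have hb2 := (hb _ (htime' s hs) (xc + lam • y)).2.2.2.2.1
      calc lam ^ 2 * (c * ‖iteratedFDeriv ℝ 2 (om (t₀ + -τ * s)) (xc + lam • y)‖)
          = c * lam ^ 2 * ‖iteratedFDeriv ℝ 2 (om (t₀ + -τ * s)) (xc + lam • y)‖ := by ring
        _ ≤ c * lam ^ 2 * M₀ := by gcongr
  -- (d) the hypotheses (5.4), (5.1), (5.3), (5.2) of the backward uniqueness theorem
  have hWb : ∀ s ∈ Ioo (0 : ℝ) 1, ∀ y,
      ‖W s y‖ = c * ‖om (t₀ + -τ * s) (xc + lam • y)‖ ∧ ‖W s y‖ ≤ c * M₀ ∧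
      ‖timeDeriv W s y‖ ≤ c * τ * M₀ := by
    intro s hs y
    obtain ⟨-, -, hb0, -, -, hbt⟩ := hb _ (htime' s hs) (xc + lam • y)
    have e1 : ‖W s y‖ = c * ‖om (t₀ + -τ * s) (xc + lam • y)‖ := by
      rw [hWapply, norm_smul, Real.norm_eq_abs, abs_of_pos hcpos]
    refine ⟨e1, e1 ▸ mul_le_mul_of_nonneg_left hb0 hcpos.le, ?_⟩
    rw [hWt s hs y, norm_smul, Real.norm_eq_abs, abs_mul, abs_of_pos hcpos, abs_neg,
      abs_of_pos hτ]
    exact mul_le_mul_of_nonneg_left hbt (by positivity)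
  have h54 : ∀ K ⊆ Ioo (0 : ℝ) 1 ×ˢ {y | 0 < ⟪y, e⟫},
      Bornology.IsBounded K → MeasurableSet K →
      ∫⁻ z in K, (‖W z.1 z.2‖ₑ ^ 2 + ‖timeDeriv W z.1 z.2‖ₑ ^ 2 +
        ‖iteratedFDeriv ℝ 2 (W z.1) z.2‖ₑ ^ 2) < ⊤ := by
    intro K hKsub hKb hKm
    have key : ∀ {G : Type} [NormedAddCommGroup G] (w : G) (v : ℝ), ‖w‖ ≤ v →
        ‖w‖ₑ ^ 2 ≤ ENNReal.ofReal v ^ 2 := fun w v hw => by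
      rw [← ofReal_norm]; exact pow_le_pow_left₀ zero_le (ENNReal.ofReal_le_ofReal hw) 2
    set B : ℝ≥0∞ := ENNReal.ofReal (c * M₀) ^ 2 + ENNReal.ofReal (c * τ * M₀) ^ 2 +
      ENNReal.ofReal (c * lam ^ 2 * M₀) ^ 2 with hB
    have hpt : ∀ z ∈ K, ‖W z.1 z.2‖ₑ ^ 2 + ‖timeDeriv W z.1 z.2‖ₑ ^ 2 +
        ‖iteratedFDeriv ℝ 2 (W z.1) z.2‖ₑ ^ 2 ≤ B := fun z hz =>
      add_le_add (add_le_add (key _ _ (hWb z.1 (hKsub hz).1 z.2).2.1)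
        (key _ _ (hWb z.1 (hKsub hz).1 z.2).2.2)) (key _ _ (hWlap z.1 (hKsub hz).1 z.2).2)
    refine lt_of_le_of_lt (setLIntegral_mono' hKm hpt) ?_
    rw [setLIntegral_const, lt_top_iff_ne_top]
    exact ENNReal.mul_ne_top (by simp [hB]) hKb.measure_lt_top.ne
  have h51 : ∀ s ∈ Ioo (0 : ℝ) 1, ∀ y, 0 < ⟪y, e⟫ →
      ‖timeDeriv W s y + (Δ (W s)) y‖ ≤
        τ * M₀ * (lam⁻¹ + 1) * (‖fderiv ℝ (W s) y‖ + ‖W s y‖) := by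
    intro s hs y hy
    have ht' := htime0' s hs
    obtain ⟨hU0, hU1, -, -, -, -⟩ := hb _ (htime' s hs) (xc + lam • y)
    -- the left-hand side through the vorticity equation
    have e1 : timeDeriv W s y + (Δ (W s)) y = (c * -τ) •
        (-convect (u (t₀ + -τ * s)) (om (t₀ + -τ * s)) (xc + lam • y) +
          convect (om (t₀ + -τ * s)) (u (t₀ + -τ * s)) (xc + lam • y)) := by
      rw [hWt s hs y, (hWlap s hs y).1, homeq _ ht' _, hlam2]
      simp only [smul_add, smul_sub, smul_neg]
      module
    have hL : ‖timeDeriv W s y + (Δ (W s)) y‖ ≤ c * τ * M₀ *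
        (‖fderiv ℝ (om (t₀ + -τ * s)) (xc + lam • y)‖ + ‖om (t₀ + -τ * s) (xc + lam • y)‖) := by
      rw [e1, norm_smul, Real.norm_eq_abs, abs_mul, abs_of_pos hcpos, abs_neg, abs_of_pos hτ]
      have h1 : ‖convect (u (t₀ + -τ * s)) (om (t₀ + -τ * s)) (xc + lam • y)‖ ≤
          ‖fderiv ℝ (om (t₀ + -τ * s)) (xc + lam • y)‖ * M₀ :=
        (ContinuousLinearMap.le_opNorm _ _).trans (mul_le_mul_of_nonneg_left hU0 (norm_nonneg _))
      have h2 : ‖convect (om (t₀ + -τ * s)) (u (t₀ + -τ * s)) (xc + lam • y)‖ ≤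
          M₀ * ‖om (t₀ + -τ * s) (xc + lam • y)‖ :=
        (ContinuousLinearMap.le_opNorm _ _).trans (mul_le_mul_of_nonneg_right hU1 (norm_nonneg _))
      calc c * τ * ‖-convect (u (t₀ + -τ * s)) (om (t₀ + -τ * s)) (xc + lam • y) +
              convect (om (t₀ + -τ * s)) (u (t₀ + -τ * s)) (xc + lam • y)‖
          ≤ c * τ * (‖fderiv ℝ (om (t₀ + -τ * s)) (xc + lam • y)‖ * M₀ +
              M₀ * ‖om (t₀ + -τ * s) (xc + lam • y)‖) := by
            gcongr
            exact (norm_add_le _ _).trans (add_le_add (by rwa [norm_neg]) h2)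
        _ = c * τ * M₀ * (‖fderiv ℝ (om (t₀ + -τ * s)) (xc + lam • y)‖ +
              ‖om (t₀ + -τ * s) (xc + lam • y)‖) := by ring
    -- the right-hand side in terms of `om`
    have eW : ‖W s y‖ = c * ‖om (t₀ + -τ * s) (xc + lam • y)‖ := (hWb s hs y).1
    have eDW : ‖fderiv ℝ (W s) y‖ = c * lam * ‖fderiv ℝ (om (t₀ + -τ * s)) (xc + lam • y)‖ := by
      rw [hWx s hs y, norm_smul, Real.norm_eq_abs, abs_of_pos (mul_pos hcpos hlampos)]
    rw [eW, eDW]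
    refine hL.trans ?_
    set a := ‖fderiv ℝ (om (t₀ + -τ * s)) (xc + lam • y)‖
    set b := ‖om (t₀ + -τ * s) (xc + lam • y)‖
    have ha : 0 ≤ a := norm_nonneg _
    have hb' : 0 ≤ b := norm_nonneg _
    have key : a + b ≤ (lam⁻¹ + 1) * (lam * a + b) := by
      have : (lam⁻¹ + 1) * (lam * a + b) = a + b + (lam * a + lam⁻¹ * b) := by
        linear_combination a * inv_mul_cancel₀ hlampos.ne'
      rw [this]
      linarith [mul_nonneg hlampos.le ha, mul_nonneg (inv_nonneg.2 hlampos.le) hb']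
    calc c * τ * M₀ * (a + b) ≤ c * τ * M₀ * ((lam⁻¹ + 1) * (lam * a + b)) := by
          gcongr
      _ = τ * M₀ * (lam⁻¹ + 1) * (c * lam * a + c * b) := by ring
  have h53 : ∀ s ∈ Ioo (0 : ℝ) 1, ∀ y, 0 < ⟪y, e⟫ → ‖W s y‖ ≤ Real.exp (0 * ‖y‖ ^ 2) := by
    intro s hs y _
    rw [zero_mul, Real.exp_zero]
    exact (hWb s hs y).2.1.trans hcM₀
  have h52 : ∀ y, 0 < ⟪y, e⟫ → W 0 y = 0 := by
    intro y hy
    rw [hWapply, mul_zero, add_zero, hR _ (hAyR y hy), smul_zero]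
  -- (e) backward uniqueness: `W ≡ 0` on `Q₊`
  have hzero := ess_backward_uniqueness_holds 3 3 e he W (τ * M₀ * (lam⁻¹ + 1)) 0 hR2 hRc h54
    h51 h53 h52
  -- (f) conclusion: undo the change of variables
  set s : ℝ := (t₀ - t) / τ with hsdef
  set y := lam⁻¹ • (x - xc) with hydef
  have hs : s ∈ Ioo (0 : ℝ) 1 :=
    ⟨div_pos (by linarith [ht.2]) hτ, (div_lt_one hτ).2 (by linarith [ht.1])⟩
  have hy : 0 < ⟪y, e⟫ := by
    have e1 : ⟪y, e⟫ = lam⁻¹ * (⟪x, e⟫ - R) := by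
      rw [hydef, real_inner_smul_left, inner_sub_left, hxc, real_inner_smul_left, hee, mul_one]
    rw [e1]
    exact mul_pos (inv_pos.2 hlampos) (by linarith [hx])
  have h0 := hzero s hs y hy
  have e1 : t₀ + -τ * s = t := by rw [hsdef]; field_simp; ring
  have e2 : xc + lam • y = x := by
    rw [hydef, smul_smul, mul_inv_cancel₀ hlampos.ne', one_smul]; abel
  rw [hWapply, e1, e2] at h0
  exact (smul_eq_zero.1 h0).resolve_left hcpos.ne'

end Class

/-! ### The stub -/

/-- **Stub `stub_vorticitySupportBackward` — vorticity vanishing outside a ball propagates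
backward in time** (portrait clause of crux `ClockCeiling`, route `ClockStretchingLaw`): for an
element `u` of the route's Type-I class (`IsTypeIAncientMild C u`), if `curl u(t₀, ·)` vanishes
on `{‖x‖ > R}` at one time `t₀ < 0`, then `curl u(t, ·)` vanishes on `{‖x‖ > R}` at every earlier
time `t ≤ t₀` — Escauriaza–Seregin–Šverák's half-space backward uniqueness
(`ess_backward_uniqueness_holds`) for the vorticity equation of the classical window, over all
half-spaces `{⟪x, e⟫ > R} ⊆ {‖x‖ > R}`, `‖e‖ = 1`, which cover `{‖x‖ > R}`. [cite: EscauriazaSereginSverak2003, Thm. 5.1 and §3 (3.32)–(3.35)] -/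
theorem stub_vorticitySupportBackward : ∀ (C : ℝ) (u : ℝ → EuclideanSpace ℝ (Fin 3) → EuclideanSpace ℝ (Fin 3)), Literature.Analysis.FluidPDE.IsTypeIAncientMild C u → ∀ (t₀ R : ℝ), t₀ < 0 → (∀ x, R < ‖x‖ → Literature.Analysis.FluidPDE.curl (u t₀) x = 0) → ∀ t ≤ t₀, ∀ x, R < ‖x‖ → Literature.Analysis.FluidPDE.curl (u t) x = 0 := by
  intro C u hu t₀ R ht₀ hR t ht x hx
  rcases eq_or_lt_of_le ht with rfl | hlt
  · exact hR x hx
  obtain ⟨e, he, hxe⟩ := vorticitySupportBackward_exists_unit x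
  have hRe : ∀ y, R < ⟪y, e⟫ → vorticity u t₀ y = 0 := fun y hy =>
    hR y (hy.trans_le (by simpa [he] using real_inner_le_norm y e))
  exact vorticitySupportBackward_halfspace hu ht₀ he hRe (τ := t₀ - t + 1) (by linarith)
    (t := t) ⟨by linarith, hlt⟩ (x := x) (by rw [hxe]; exact hx)

end Summit.NavierStokesRegularity.NavierStokesRegularity.Theorems

end
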